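import Summits.ABC.StewartYu.PadicG3TwoFrameSat
import Summits.ABC.StewartYu.PadicG3TwoScheduleS
import Summits.ABC.StewartYu.PadicG3ParC
import HarnessLib

/-!
# Cell abc-stewartyu, WP-L.P(2) (crux r4 `PadicCoreTwoRat`, stmt-ABC-20504), record interface: the SCHEDULE OF RECORD of the
# 𝔑-THREADED `2`-adic frame, `schedTwoN S F P` — p5's `schedTwoS` with the four `N`-edits (depth, floored decrement with an order
# reserve, `Y₀`-degree `÷ N`, virtual boxes)

`Summits/ABC/StewartYu/PadicG3TwoSchedSatN.lean` — cell `abc-stewartyu` (HOME `run/shared/lean/pub/abc-stewartyu/`), route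
`YuMatveevShapeRat`, seat p3 (g10, WP-L.P(2) lead; design line STATUS 2026-08-27T18:43Z, twin of p1's ParN design (N1)–(N4) for the
odd core and of p2's `PadicG3SatNSched`).  Definitions (closed forms and the schedule `schedTwoN : S.G3TwoSched`) and elementary theorems; no
named fact.  The record is a plain `P : PadicG3Par (d+1)` (p3-g6's `parTwo` instantiation at the budget letter `W̃`); the saturation index is
`N := F.N` of the set-up's `SatData`.

THE FOUR `N`-EDITS of `schedTwoS S P` (everything else — `m`, `H`, `M`, `X`, `L`, the `ν(H)^t` denominators, the `2`-adic weight line,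
`d + 3` k-steps per level — is p5's, by name where possible):
* (N1) DEPTH `Istar3N = ⌈log₃(2^{n+24+m}·N)⌉` (`n = d + 1`; so the last virtual box `2N·sⱼ/3^{I*}` is below the landed END box), the
  decrement FLOORED `T3N I = max 8 (4L/3^I)`, ranges `Xs3N I = 4XL/(T3N I + 1)` (capped product), and start orders WITH A LINEAR RESERVE
  `T03N I = M/(n+2)³ + 2(n+2)·T3N I + 1 + 16(n+2)·(Istar3N + 1 − I)` — so that the third step keeps multiplicity `≥ 1` also on the
  floored levels (`T03N_budget`);
* (N2) the `Y₀`-DEGREE DIVIDED BY `N`: `L03N = ⌈6X·C_bⁿ·Ω·K/N⌉` (the Siegel count runs over the skew family `𝔑 ∩ N·box`, sequel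
  `PadicG3TwoSatPack`);
* (N3) boxes: α-box half-sides `sN j = P.side j + 1`, VIRTUAL schedule `Bv3N 0 j = N·sN j`, `Bv3N I j = 2N·sN j/3^I` (`I ≥ 1`), uniform
  ϑ-coordinate box `Dco = (d+1)!·N·Σⱼ sN j` shrinking the same way (`DcoR`), directional bound `Xb3N I = 1 + (|b̃_θ| + Σ|b̃ⱼ|)·DcoR I`,
  family-size slot `cardBN = (L03N+1)·(2Dco+1)^{d+1}`, Hasse sizes `M₀3N` (= `M₀3` at `(Istar3N, L03N)`), weight bound `Bw3N`, and the
  level-`0` Siegel size `Amax3N` with the VIRTUAL clearing denominator `F.Dm (Bv3N 0)`;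
* (N4) the budget letter is `P.W` itself (the record instantiates `P.W := W̃ ≥ log N`).

Theorems: `rfl` projections `schedTwoN_*`; `T3N_ge` (`8 ≤ T3N I`), `T3N_succ_le`, **`T03N_budget`** (`(d+3)·T3N I ≤ T03N I` and
`T03N (I+1) + 1 + (d+3)·T3N I ≤ T03N I` for `I < Istar3N`), `Tfin_schedTwoN_ge`; box recursions `DcoR_succ`/`Bv3N_succ`; `Xb3N_ge`,
`Bw3N_ge`, `M₀3N_ge`, `M₀3N_le_M₀E3N`, `prod_le_Amax3N`, `KTwoSat_schedTwoN_pos`.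

WHAT THIS IS NOT: the pre-family and the reduction of `FrameNumericsTwoRASat` to budget lines (sequel `PadicG3TwoSatPack`), sizes, budgets,
numbers; no crux moves (A1.L not moved).

References: Yu. V. Nesterenko, LNM 1819 (2003), §3.4–§3.5 (`N = [𝔑:ℤⁿ]`, (3.23)–(3.24)), §4 (4.3)–(4.5), (4.35), §5.2; K. Yu, Acta
Math. 211 (2013), §3.1, (5.13)–(5.16), (5.22); HOME/p1/memo/ParN-design-g10.md §0; HOME/p3/memo-12.
-/

noncomputable section

open Finset Polynomial
open scoped Matrix Nat
open Literature.NumberTheory.Transcendental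
open Literature.NumberTheory.Transcendental (FeldmanDelta.den)
open Literature.NumberTheory.Transcendental.FeldmanDelta
open Literature.NumberTheory.Transcendental.CW77.Setup (Tau tauNorm)
open Literature.NumberTheory.Transcendental.PadicCW77 (condExp)

namespace Summit.ABC.StewartYu

namespace TwoSetup

open Summit.ABC.StewartYu.FeldmanBasis Summit.ABC.StewartYu.G3Boxes PadicG3Par

variable (S : TwoSetup) (F : S.SatData) (P : PadicG3Par (S.d + 1))

/-! ### (N1) The triadic level schedule with depth `⌈log₃(2^{n+24+m}·N)⌉`, floored decrement and order reserve -/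

/-- **Depth** `I*N = ⌈log₃(2^{n+24+m}·N)⌉` (`n = d + 1`): `3^{I*N} ≥ 2^{n+24+m}·N`. [cite: Nesterenko2003, (3.24) with p.107; shape only] -/
def Istar3N : ℕ := Nat.clog 3 (2 ^ (S.d + 1 + 24 + P.m) * F.N)

/-- **Decrement, floored** `T3N I = max 8 (⌊4L/3^I⌋)`. [cite: Nesterenko2003, (4.3); shape only] -/
def T3N (I : ℕ) : ℕ := max 8 (4 * P.L / 3 ^ I)

/-- **Base range** `Xs3N I = ⌊4XL/(T3N I + 1)⌋` (capped product `Xs3N I·(T3N I+1) ≈ 4XL` at every level, `= 4XL/9` once floored).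
[cite: Nesterenko2003, (4.3); shape only] -/
def Xs3N (I : ℕ) : ℕ := 4 * P.X * P.L / (S.T3N P I + 1)

/-- **Start order** of level `I` with the linear reserve: `⌊M/(n+2)³⌋ + 2(n+2)·T3N I + 1 + 16(n+2)·(I*N + 1 − I)`.
[cite: Nesterenko2003, (4.5); shape only] -/
def T03N (I : ℕ) : ℕ :=
  P.M / (S.d + 1 + 2) ^ 3 + 2 * (S.d + 1 + 2) * S.T3N P I + 1 + 16 * (S.d + 1 + 2) * (S.Istar3N F P + 1 - I)

/-- **Range after `k` sub-steps** of level `I`: `3^k·Xs3N I` for `k ≥ 1`; at `k = 0` the level's input range (`X` at level `0`, the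
coprime nodes `|x| ≤ 3·Xs3N I` after a third step). [cite: Yu2013, Lemma 5.2 (5.23); shape only] -/
def Nsub3N (I k : ℕ) : ℕ :=
  if k = 0 then (if I = 0 then P.X else 3 * S.Xs3N P I) else 3 ^ k * S.Xs3N P I

/-- The level-`0` input range is `X`. [folklore] -/
@[simp] theorem Nsub3N_zero_zero : S.Nsub3N P 0 0 = P.X := by simp [Nsub3N]

/-- `8 ≤ T3N I` (the floor). [folklore] -/
theorem T3N_ge (I : ℕ) : 8 ≤ S.T3N P I := le_max_left _ _

/-- `T3N (I+1) ≤ max 8 (T3N I / 3)`. [folklore] -/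
theorem T3N_succ_le (I : ℕ) : S.T3N P (I + 1) ≤ max 8 (S.T3N P I / 3) := by
  unfold T3N
  refine max_le (le_max_left _ _) (le_trans ?_ (le_max_right _ _))
  rw [pow_succ, ← Nat.div_div_eq_div_mul]
  exact Nat.div_le_div_right (le_max_right _ _)

/-- `1 ≤ T03N I`. [folklore] -/
theorem one_le_T03N (I : ℕ) : 1 ≤ S.T03N F P I := by
  unfold T03N
  exact le_trans (Nat.le_add_left 1 _) (Nat.le_add_right _ _)

/-- **The order bookkeeping of a level** (`d + 3` k-steps of decrement `T3N I`, then the third step): `(d+3)·T3N I ≤ T03N I`, and for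
`I < I*N` also `T03N (I+1) + 1 + (d+3)·T3N I ≤ T03N I` — in the geometric regime because `T3N (I+1) ≤ T3N I/3`, on the floored levels
because the reserve drops by `16(n+2)` per level. [folklore] -/
theorem T03N_budget (I : ℕ) :
    (S.d + 3) * S.T3N P I ≤ S.T03N F P I ∧
      (I < S.Istar3N F P → S.T03N F P (I + 1) + 1 + (S.d + 3) * S.T3N P I ≤ S.T03N F P I) := by
  have hT := S.T3N_ge P I
  have hsucc := S.T3N_succ_le P I
  have h3 : 3 * (S.T3N P I / 3) ≤ S.T3N P I := Nat.mul_div_le _ 3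
  unfold T03N
  have ea : S.d + 1 + 2 = S.d + 3 := by ring
  rw [ea]
  have ha : 3 ≤ S.d + 3 := Nat.le_add_left 3 _
  generalize P.M / (S.d + 3) ^ 3 = M₃
  generalize S.Istar3N F P = Is
  generalize S.T3N P I = T at hT hsucc h3 ⊢
  generalize S.T3N P (I + 1) = T' at hsucc ⊢
  generalize S.d + 3 = a at ha ⊢
  have haT : 24 ≤ a * T := by nlinarith
  constructor
  · nlinarith
  · intro hI
    have hres : Is + 1 - I = (Is + 1 - (I + 1)) + 1 := by omega
    rw [hres]
    generalize Is + 1 - (I + 1) = J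
    rcases le_max_iff.mp hsucc with h8 | hthird
    · have h1 : 2 * a * T' ≤ 2 * a * 8 := Nat.mul_le_mul_left _ h8
      nlinarith
    · have h4 : 3 * (2 * a * T') ≤ 2 * a * T :=
        calc 3 * (2 * a * T') ≤ 3 * (2 * a * (T / 3)) := by gcongr
          _ = 2 * a * (3 * (T / 3)) := by ring
          _ ≤ 2 * a * T := Nat.mul_le_mul_left _ h3
      nlinarith

/-! ### (N2) The `Y₀`-degree divided by `N` -/

/-- **The `Y₀`-degree `L03N = ⌈6 X C_bⁿ Ω K / N⌉`** (Siegel over `𝔑`: `÷ N`). [cite: Nesterenko2003, (3.23) with §3.5; shape only] -/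
def L03N : ℕ := ⌈6 * P.X * Cb ^ (S.d + 1) * P.Ω * P.K / F.N⌉₊

/-! ### (N3) Boxes, weights and sizes -/

/-- **α-box half-sides** `sN j = ⌊L/(2Aⱼ)⌋ + 1 = P.side j + 1`. [cite: Nesterenko2003, (3.22); shape only] -/
def sN (j : Fin (S.d + 1)) : ℕ := P.side j + 1

/-- **The uniform ϑ-coordinate box** `Dco = (d+1)!·N·Σⱼ sN j` (contains `μ` whenever `|Cⱼₖ| ≤ (d+1)!·N` and `μ = λ ᵥ* C`, `|λⱼ| ≤ sN j`;
only its logarithm enters the budget). [folklore] -/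
def Dco : ℕ := (S.d + 1)! * F.N * ∑ j, S.sN P j

/-- **ϑ-coordinate box at level `I`**: `Dco` at `I = 0`, `2·Dco/3^I` at `I ≥ 1`. [cite: Nesterenko2003, §4.3 (4.35); shape only] -/
def DcoR (I : ℕ) : ℕ := if I = 0 then S.Dco F P else 2 * S.Dco F P / 3 ^ I

/-- **The VIRTUAL exponent schedule**: `N·sN j` at `I = 0`, `2·N·sN j/3^I` at `I ≥ 1`. [cite: Nesterenko2003, §3.5 and (4.35); shape only] -/
def Bv3N (I : ℕ) (j : Fin (S.d + 1)) : ℕ := if I = 0 then F.N * S.sN P j else 2 * (F.N * S.sN P j) / 3 ^ I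

/-- **Directional bound at level `I`**: `1 + (|b̃_θ| + Σⱼ|b̃ⱼ|)·DcoR I`. [folklore] -/
def Xb3N (I : ℕ) : ℤ := 1 + (|S.bθ| + ∑ j, |S.b j|) * (S.DcoR F P I : ℤ)

/-- **Family-size slot** `cardBN = (L03N+1)·∏(2·Dco+1)·(2·Dco+1)` (the coordinate box count, level-independent). [folklore] -/
def cardBN : ℕ := (S.L03N F P + 1) * ((∏ _j : Fin S.d, (2 * S.Dco F P + 1)) * (2 * S.Dco F P + 1))

/-- **`2`-adic weight bound** `max_{ℓ ≤ L03N} ‖den(ℓ,H)⁻¹‖₂·(4·2^m)^ℓ`. [cite: Nesterenko2003, §3.1; shape only] -/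
def Bw3N : ℝ := (Finset.range (S.L03N F P + 1)).sup' ⟨0, by simp⟩
  fun ℓ => ‖((den ℓ P.H : ℚ_[2]))⁻¹‖ * (4 * (2 : ℝ) ^ P.m) ^ ℓ

/-- **Hasse size** at level `I`, point `x`, multi-index `τ`:
`⌈3^{(I*N−I)t}·ν(H)^t·e^{H/e}·(e(1+3^{I*N−I}|x|/H))^{L03N}⌉`. [cite: Nesterenko2003, §3.1 Prop 3.1; shape only] -/
def M₀3N (I : ℕ) (x : ℤ) (τ : Tau S.d) : ℤ :=
  ⌈(3 : ℝ) ^ ((S.Istar3N F P - I) * τ.1) * ((Nat.lcmUpto P.H : ℝ) ^ τ.1 *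
    (Real.exp (P.H / Real.exp 1) *
      (Real.exp 1 * (1 + (3 : ℝ) ^ (S.Istar3N F P - I) * |(x : ℝ)| / P.H)) ^ S.L03N F P))⌉

/-- The uniform Hasse size on the level-`0` equations. [folklore] -/
def M₀E3N (hT : 1 ≤ S.T03N F P 0) : ℤ :=
  (eqSet S.d P.X (S.T03N F P 0)).sup' (eqSet_nonempty S.d P.X hT) fun e => S.M₀3N F P 0 e.1 e.2

/-- The level-`0` Siegel coefficient size `Amax` with the VIRTUAL clearing denominator `F.Dm (Bv3N 0)` (exact finite maximum, `≥ 1`).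
[cite: Yu2013, (4.28); shape only] -/
def Amax3N (hT : 1 ≤ S.T03N F P 0) : ℝ :=
  max 1 ((eqSet S.d P.X (S.T03N F P 0)).sup' (eqSet_nonempty S.d P.X hT) fun e =>
    (S.M₀E3N F P hT : ℝ) * (S.Xb3N F P 0 : ℝ) ^ (∑ j, e.2.2 j) * ((F.Dm (S.Bv3N F P 0) e.1 : ℝ)) ^ 2)

/-! ### The schedule of record -/

/-- **THE SCHEDULE OF RECORD `σ₂ᴺ` OF THE 𝔑-THREADED `2`-ADIC FRAME**, instantiated from `P : PadicG3Par (d+1)` and `N := F.N`.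
[cite: Nesterenko2003, §4 (4.3)–(4.5), (4.35), §3.5; shape only] -/
def schedTwoN : S.G3TwoSched where
  Istar := S.Istar3N F P
  m := P.m
  D₀ := S.L03N F P
  P := ⌈(S.cardBN F P : ℝ) * S.Amax3N F P (S.one_le_T03N F P 0)⌉
  cardB := fun _ => S.cardBN F P
  Dbox := fun I _ => S.DcoR F P I
  Dθ := S.DcoR F P
  Xb := S.Xb3N F P
  Bw := fun _ => S.Bw3N F P
  den₀ := fun _ _ τ => Nat.lcmUpto P.H ^ τ.1
  M₀ := S.M₀3N F P
  N0 := fun I => S.Nsub3N P I 0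
  T0 := S.T03N F P
  Nfin := fun I => 3 ^ (S.d + 3) * S.Xs3N P I
  Tfin := fun I => S.T03N F P I - (S.d + 3) * S.T3N P I
  kst := fun _ => S.d + 3
  tdec := S.T3N P
  Nsub := S.Nsub3N P

/-! ### Projections (`rfl`) -/

/-- Projection of `schedTwoN`. [folklore] -/
@[simp] theorem schedTwoN_Istar : (S.schedTwoN F P).Istar = S.Istar3N F P := rfl
/-- Projection of `schedTwoN`. [folklore] -/
@[simp] theorem schedTwoN_m : (S.schedTwoN F P).m = P.m := rfl
/-- Projection of `schedTwoN`. [folklore] -/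
@[simp] theorem schedTwoN_D₀ : (S.schedTwoN F P).D₀ = S.L03N F P := rfl
/-- Projection of `schedTwoN`. [folklore] -/
@[simp] theorem schedTwoN_cardB (I : ℕ) : (S.schedTwoN F P).cardB I = S.cardBN F P := rfl
/-- Projection of `schedTwoN`. [folklore] -/
@[simp] theorem schedTwoN_Dbox (I : ℕ) (j : Fin S.d) : (S.schedTwoN F P).Dbox I j = S.DcoR F P I := rfl
/-- Projection of `schedTwoN`. [folklore] -/
@[simp] theorem schedTwoN_Dθ : (S.schedTwoN F P).Dθ = S.DcoR F P := rfl
/-- Projection of `schedTwoN`. [folklore] -/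
@[simp] theorem schedTwoN_Xb : (S.schedTwoN F P).Xb = S.Xb3N F P := rfl
/-- Projection of `schedTwoN`. [folklore] -/
@[simp] theorem schedTwoN_Bw (I : ℕ) : (S.schedTwoN F P).Bw I = S.Bw3N F P := rfl
/-- Projection of `schedTwoN`. [folklore] -/
@[simp] theorem schedTwoN_den₀ (I : ℕ) (x : ℤ) (τ : Tau S.d) :
    (S.schedTwoN F P).den₀ I x τ = Nat.lcmUpto P.H ^ τ.1 := rfl
/-- Projection of `schedTwoN`. [folklore] -/
@[simp] theorem schedTwoN_M₀ : (S.schedTwoN F P).M₀ = S.M₀3N F P := rfl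
/-- Projection of `schedTwoN`. [folklore] -/
@[simp] theorem schedTwoN_N0 (I : ℕ) : (S.schedTwoN F P).N0 I = S.Nsub3N P I 0 := rfl
/-- Projection of `schedTwoN`. [folklore] -/
@[simp] theorem schedTwoN_T0 : (S.schedTwoN F P).T0 = S.T03N F P := rfl
/-- Projection of `schedTwoN`. [folklore] -/
@[simp] theorem schedTwoN_Nfin (I : ℕ) : (S.schedTwoN F P).Nfin I = 3 ^ (S.d + 3) * S.Xs3N P I := rfl
/-- Projection of `schedTwoN`. [folklore] -/
@[simp] theorem schedTwoN_Tfin (I : ℕ) : (S.schedTwoN F P).Tfin I = S.T03N F P I - (S.d + 3) * S.T3N P I := rfl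
/-- Projection of `schedTwoN`. [folklore] -/
@[simp] theorem schedTwoN_kst (I : ℕ) : (S.schedTwoN F P).kst I = S.d + 3 := rfl
/-- Projection of `schedTwoN`. [folklore] -/
@[simp] theorem schedTwoN_tdec : (S.schedTwoN F P).tdec = S.T3N P := rfl
/-- Projection of `schedTwoN`. [folklore] -/
@[simp] theorem schedTwoN_Nsub : (S.schedTwoN F P).Nsub = S.Nsub3N P := rfl
/-- Projection of `schedTwoN`. [folklore] -/
@[simp] theorem schedTwoN_P : (S.schedTwoN F P).P = ⌈(S.cardBN F P : ℝ) * S.Amax3N F P (S.one_le_T03N F P 0)⌉ := rfl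

/-! ### Structural facts -/

/-- Level-`0` ϑ-box. [folklore] -/
@[simp] theorem DcoR_zero : S.DcoR F P 0 = S.Dco F P := if_pos rfl

/-- Deep ϑ-boxes: `DcoR (I+1) = 2·Dco/3^{I+1}`. [folklore] -/
theorem DcoR_succ (I : ℕ) : S.DcoR F P (I + 1) = 2 * S.Dco F P / 3 ^ (I + 1) := if_neg (Nat.succ_ne_zero I)

/-- Level-`0` virtual box: `N·sN j`. [folklore] -/
@[simp] theorem Bv3N_zero (j : Fin (S.d + 1)) : S.Bv3N F P 0 j = F.N * S.sN P j := if_pos rfl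

/-- Deep virtual boxes: `Bv3N (I+1) j = 2·(N·sN j)/3^{I+1}`. [folklore] -/
theorem Bv3N_succ (I : ℕ) (j : Fin (S.d + 1)) : S.Bv3N F P (I + 1) j = 2 * (F.N * S.sN P j) / 3 ^ (I + 1) :=
  if_neg (Nat.succ_ne_zero I)

/-- The box recursion of the schedule: `2·DcoR 0/3^{I+1} ≤ DcoR (I+1)` (with equality). [folklore] -/
theorem DcoR_rec (I : ℕ) : 2 * (S.DcoR F P 0 : ℤ) / 3 ^ (I + 1) ≤ (S.DcoR F P (I + 1) : ℤ) := by
  rw [DcoR_zero, DcoR_succ]; push_cast; exact le_rfl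

/-- The virtual box recursion: `2·Bv3N 0 j/3^{I+1} ≤ Bv3N (I+1) j` (with equality). [folklore] -/
theorem Bv3N_rec (I : ℕ) (j : Fin (S.d + 1)) : 2 * (S.Bv3N F P 0 j : ℤ) / 3 ^ (I + 1) ≤ (S.Bv3N F P (I + 1) j : ℤ) := by
  rw [Bv3N_zero, Bv3N_succ]; push_cast; exact le_rfl

/-- The directional bound dominates `|b̃_θ|·DcoR I + |b̃ⱼ|·DcoR I`. [folklore] -/
theorem Xb3N_ge (I : ℕ) (j : Fin S.d) :
    |S.bθ| * (S.DcoR F P I : ℤ) + |S.b j| * (S.DcoR F P I : ℤ) ≤ S.Xb3N F P I := by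
  unfold Xb3N
  have h2 : |S.b j| ≤ ∑ j', |S.b j'| :=
    Finset.single_le_sum (f := fun j' => |S.b j'|) (fun _ _ => abs_nonneg _) (Finset.mem_univ j)
  have h3 : (0 : ℤ) ≤ S.DcoR F P I := by positivity
  nlinarith [abs_nonneg S.bθ, mul_le_mul_of_nonneg_right h2 h3]

/-- `1 ≤ Xb3N I`. [folklore] -/
theorem one_le_Xb3N (I : ℕ) : 1 ≤ S.Xb3N F P I := by
  unfold Xb3N
  have h1 : (0 : ℤ) ≤ (|S.bθ| + ∑ j, |S.b j|) * (S.DcoR F P I : ℤ) :=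
    mul_nonneg (add_nonneg (abs_nonneg _) (Finset.sum_nonneg fun _ _ => abs_nonneg _)) (by positivity)
  linarith

/-- `0 ≤ Xb3N I`. [folklore] -/
theorem Xb3N_nonneg (I : ℕ) : 0 ≤ S.Xb3N F P I := le_trans zero_le_one (S.one_le_Xb3N F P I)

/-- The `2`-adic weight line at every `ℓ ≤ L03N`. [folklore] -/
theorem Bw3N_ge (ℓ : ℕ) (hℓ : ℓ ≤ S.L03N F P) :
    ‖((den ℓ P.H : ℚ_[2]))⁻¹‖ * (4 * (2 : ℝ) ^ P.m) ^ ℓ ≤ S.Bw3N F P := by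
  unfold Bw3N
  exact Finset.le_sup' (fun ℓ => ‖((den ℓ P.H : ℚ_[2]))⁻¹‖ * (4 * (2 : ℝ) ^ P.m) ^ ℓ)
    (Finset.mem_range.mpr (by omega))

/-- The Hasse-size line at every `ℓ ≤ L03N`. [folklore] -/
theorem M₀3N_ge (I : ℕ) (x : ℤ) (τ : Tau S.d) (ℓ : ℕ) (hℓ : ℓ ≤ S.L03N F P) :
    (3 : ℝ) ^ ((S.Istar3N F P - I) * τ.1) * ((Nat.lcmUpto P.H : ℝ) ^ τ.1 *
      (Real.exp (P.H / Real.exp 1) *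
        (Real.exp 1 * (1 + (3 : ℝ) ^ (S.Istar3N F P - I) * |(x : ℝ)| / P.H)) ^ ℓ)) ≤ S.M₀3N F P I x τ := by
  unfold M₀3N
  refine le_trans ?_ (Int.le_ceil _)
  have hbase : (1 : ℝ) ≤ Real.exp 1 * (1 + (3 : ℝ) ^ (S.Istar3N F P - I) * |(x : ℝ)| / P.H) := by
    have h1 : (1 : ℝ) ≤ Real.exp 1 := Real.one_le_exp zero_le_one
    have h2 : (0 : ℝ) ≤ (3 : ℝ) ^ (S.Istar3N F P - I) * |(x : ℝ)| / P.H := by positivity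
    nlinarith
  gcongr

/-- `0 < M₀3N I x τ`. [folklore] -/
theorem M₀3N_pos (I : ℕ) (x : ℤ) (τ : Tau S.d) : (0 : ℝ) < (S.M₀3N F P I x τ : ℝ) := by
  have h := S.M₀3N_ge F P I x τ 0 (Nat.zero_le _)
  rw [pow_zero, mul_one] at h
  have hpos : (0 : ℝ) < (3 : ℝ) ^ ((S.Istar3N F P - I) * τ.1) * ((Nat.lcmUpto P.H : ℝ) ^ τ.1 *
      Real.exp (P.H / Real.exp 1)) := by
    have : (0 : ℝ) < (Nat.lcmUpto P.H : ℝ) := by exact_mod_cast Nat.lcmUpto_pos P.H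
    positivity
  exact hpos.trans_le h

/-- The uniform Hasse size dominates on the level-`0` equations. [folklore] -/
theorem M₀3N_le_M₀E3N (hT : 1 ≤ S.T03N F P 0) {e : ℤ × Tau S.d} (he : e ∈ eqSet S.d P.X (S.T03N F P 0)) :
    S.M₀3N F P 0 e.1 e.2 ≤ S.M₀E3N F P hT := by
  unfold M₀E3N
  exact Finset.le_sup' (fun e : ℤ × Tau S.d => S.M₀3N F P 0 e.1 e.2) he

/-- The Siegel coefficient size dominates on the level-`0` equations. [folklore] -/
theorem prod_le_Amax3N (hT : 1 ≤ S.T03N F P 0) {e : ℤ × Tau S.d} (he : e ∈ eqSet S.d P.X (S.T03N F P 0)) :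
    (S.M₀E3N F P hT : ℝ) * (S.Xb3N F P 0 : ℝ) ^ (∑ j, e.2.2 j) * ((F.Dm (S.Bv3N F P 0) e.1 : ℝ)) ^ 2 ≤
      S.Amax3N F P hT := by
  unfold Amax3N
  refine le_trans ?_ (le_max_right _ _)
  exact Finset.le_sup' (fun e : ℤ × Tau S.d => (S.M₀E3N F P hT : ℝ) * (S.Xb3N F P 0 : ℝ) ^ (∑ j, e.2.2 j) *
    ((F.Dm (S.Bv3N F P 0) e.1 : ℝ)) ^ 2) he

/-- `1 ≤ Amax3N`. [folklore] -/
theorem one_le_Amax3N (hT : 1 ≤ S.T03N F P 0) : 1 ≤ S.Amax3N F P hT := le_max_left _ _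

/-- `1 ≤ cardBN`. [folklore] -/
theorem one_le_cardBN : 1 ≤ S.cardBN F P := by
  unfold cardBN
  exact Nat.one_le_iff_ne_zero.mpr (by positivity)

/-- `1 ≤ ⌈cardBN·Amax3N⌉` (the coefficient slot is a positive integer). [folklore] -/
theorem one_le_P_schedTwoN : 1 ≤ (S.schedTwoN F P).P := by
  rw [schedTwoN_P]
  have hc : (1 : ℝ) ≤ (S.cardBN F P : ℝ) := by exact_mod_cast S.one_le_cardBN F P
  have hA := S.one_le_Amax3N F P (S.one_le_T03N F P 0)
  exact Int.one_le_ceil_iff.mpr (by nlinarith)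

/-- `KTwoSat` of the schedule is positive. [folklore] -/
theorem KTwoSat_schedTwoN_pos (I : ℕ) (x : ℤ) (τ : Tau S.d) : 0 < KTwoSat (S.schedTwoN F P) F (S.Bv3N F P) I x τ := by
  unfold KTwoSat
  have hcard : (0 : ℝ) < ((S.schedTwoN F P).cardB I : ℝ) := by
    rw [schedTwoN_cardB]; exact_mod_cast S.one_le_cardBN F P
  have hP : (0 : ℝ) < ((S.schedTwoN F P).P : ℝ) := by exact_mod_cast S.one_le_P_schedTwoN F P
  have hM : (0 : ℝ) < ((S.schedTwoN F P).M₀ I x τ : ℝ) := by rw [schedTwoN_M₀]; exact S.M₀3N_pos F P I x τ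
  have hXb : (0 : ℝ) < ((S.schedTwoN F P).Xb I : ℝ) ^ (∑ j, τ.2 j) := by
    rw [schedTwoN_Xb]
    refine pow_pos ?_ _
    exact_mod_cast (show (0 : ℤ) < S.Xb3N F P I by have := S.one_le_Xb3N F P I; omega)
  have hDm : (0 : ℝ) < ((F.Dm (S.Bv3N F P I) x : ℝ)) ^ 2 := by
    have := F.one_le_Dm (S.Bv3N F P I) x
    positivity
  positivity

/-- The END order line of the schedule: `⌊M/(n+2)³⌋ + 1 ≤ Tfin I` at every level (the reserve and the floor only add).
[cite: Nesterenko2003, (5.8); shape only] -/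
theorem Tfin_schedTwoN_ge (I : ℕ) : P.M / (S.d + 1 + 2) ^ 3 + 1 ≤ (S.schedTwoN F P).Tfin I := by
  rw [schedTwoN_Tfin]
  unfold T03N
  have ea : S.d + 1 + 2 = S.d + 3 := by ring
  rw [ea]
  generalize S.T3N P I = T
  generalize P.M / (S.d + 3) ^ 3 = M₃
  generalize S.Istar3N F P + 1 - I = R
  have : (S.d + 3) * T ≤ 2 * (S.d + 3) * T := by nlinarith
  omega

/-- The depth inequality: `2^{n+24+m}·N ≤ 3^{I*N}`. [cite: Nesterenko2003, (3.24); shape only] -/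
theorem le_three_pow_Istar3N : 2 ^ (S.d + 1 + 24 + P.m) * F.N ≤ 3 ^ S.Istar3N F P :=
  Nat.le_pow_clog (by norm_num) _

end TwoSetup

end Summit.ABC.StewartYu

end
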